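/-
Copyright (c) 2026 the pub-hodgecm-mathlib formalisation cell (harness21).  Prover seat hodgecm-mathlib-K2Liu-p14 (g0): Track B «K2-LIT»,
hLiu418 = stmt-HodgeConjecture-24832; LEAD F0P6-plan (g13) RULING M-157b + «=» 2026-09-04T08:59:05Z «(β4-ii) FIRST», file (β4-ii) part 2.
-/
import Summits.HodgeConjecture.HodgeConjecture.Theorems.K2LiuIdelicEulerLimit            -- ★ part 1 (box-to-idele limit, the local factors `μ_v(𝒪_vˣ)`, `μ_v(𝒪_vˣ)ζ_v(w)`)
import Summits.HodgeConjecture.HodgeConjecture.Theorems.F0P2wPartialDedekindZetaPole     -- ★ `hasProd_partialDedekindZeta`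
import Literature.NumberTheory.Automorphic.HeckeIntegralPureTensorAbsConv                 -- ★ `integrable_of_norm_eq_mul_prod_on_ideleUnitBox`
import Literature.NumberTheory.Automorphic.RankinSelbergTorusPointwise                    -- ★ `isOpen_setOf_forall_valued_snd_{eq,le}_one`
import HarnessLib

/-!
# Crux `HLiu418`, road `K2_Liu`, Road Φ organ G5 (β) «Godement sections exhaust», file (β4-ii) part 2:
# THE UNRAMIFIED IDELIC ZETA PRODUCT `∫_{𝕀_K} g(a_∞) 𝟙_D(a) |a|^w dν(a) = c_S · (∫ g N^w dμ_∞) · (∏_{v∈S} μ_v(𝒪_vˣ)) · ζ_K^S(w)`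

Cell `hodgecm-mathlib`, crux item hLiu418 = `stmt-HodgeConjecture-24832`; prover K2Liu-p14 (g0).  THEOREMS ONLY (no `def`, no instance, no notation,
no named-fact hypothesis, no `sorry`); lane `--supports stmt-HodgeConjecture-24832` (count-neutral helper).  GENERIC number field `K`, finite `S`, `1 < re w`.
THE INTEGRAND `F(a) = g(a_∞) · 𝟙_D(a) · |a|^w`, `D = D_S = {a ∈ 𝕀_K : |a_v|_v = 1 (v ∈ S), |a_v|_v ≤ 1 (v ∉ S)}` (`a_∞ = archUnitsOfIdele K a`, `|a| = ideleNorm K a`):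
`𝟙_D` is the finite-adelic part `𝟙_{∏_{v∈S} 𝒪_vˣ × ∏_{v∉S}(𝒪_v∖0)}` of the Godement datum of a flat section spherical off `S` ((β4-i)), so `∫ F dν` is the idelic
coefficient of the Godement section ((β4-iii)).  Currency: the ★ idele toolkit `IdeleUnitBox{Shells,Splitting,SplittingConstants,Exhaustion}` (boxes
`B(Sᶜ) = ideleUnitBox {w | w ∉ S}`, splitting `(Θ_S)_*(ν|_{B(Sᶜ)}) = c_S • (μ_∞ ⊗ ⊗_{v∈S} μ_v)` = hypothesis `hc`; `c_S` CARRIED BY NAME, never evaluated — LEAD r1);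
Borel structures on `𝕀_K`, `K_∞ˣ` and every `K_v` (Tate's setting of ★ part 1; `K_vˣ` carries Mathlib's `Units.instMeasurableSpace`, Borel by ★ `Units.borelSpace`).
* §0 integrability of the local functions `𝟙_{𝒪_vˣ}|·|_v^w`, `𝟙_{𝒪_v∖0}|·|_v^w` (`0 < re w`; ★ Tate `integrable_units_of_norm_le`);
* §1 on the box `B(S'ᶜ)`, `S ⊆ S'`: `𝟙_D(a) = ∏_{v∈S'} 𝟙_{E_v}(a_v)` (`E_v = 𝒪_vˣ` on `S`, `𝒪_v∖0` off `S`), `F(a) = [g N^w](a_∞) · ∏_{v∈S'} 𝟙_{E_v}(a_v)|a_v|_v^w`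
  (★ `ideleNorm_cpow_eq_of_mem_ideleUnitBox`); `D` is open;
* §2 THE BOX IDENTITY `∫_{B((S∪T)ᶜ)} F dν = c_S · (∫ g N^w dμ_∞) · (∏_{v∈S} μ_v(𝒪_vˣ)) · ∏_{t∈T} (1 − q_t^{−w})⁻¹` (★ `exists_splittingConst_ideleUnitBox_compl` at `S ∪ T`,
  ★ `splittingConst_eq_mul_prod_of_subset`, ★ part 1 local factors) and the INTEGRABILITY of `F` (★ `integrable_of_norm_eq_mul_prod_on_ideleUnitBox` with
  `a_t = ζ_t(re w) − 1 ≤ q_t^{−re w}∕(1 − 2^{−re w})`, ★ `summable_residueCard_rpow_neg`);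
* §3 MAIN **`integral_arch_mul_indicator_mul_ideleNorm_cpow_eq`** (★ part 1 `integral_eq_mul_of_forall_setIntegral_box_eq` + ★ `hasProd_partialDedekindZeta`,
  `ζ_K^S(w) = partialStandardL S (fun _ ↦ {1}) w`) and its `∃ c_S ≠ 0` packaging for a Haar `ν` (★ `ne_zero_of_map_restrict_ideleUnitBox_compl_eq_smul`).
Tate's `∫_{𝕀_S} = ∏_v ∫_{k_vˣ}` (Cassels–Fröhlich XV Thm. 4.4.1) for this factorizable integrand, as a limit over boxes exactly as Jacquet–Langlands' «`Ψ = ∏_v Ψ_v`»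
(★ `HeckeIntegralPureTensorEuler`, the template).  HONEST LABEL.  `HC_CM` is proved only modulo the 7 printed citations (2 remaining named inputs:
hLiu418 = `stmt-HodgeConjecture-24832`, h413 = `stmt-HodgeConjecture-24833`) until rung 0 closes.

## References
* [CasselsFrohlichANT1967] J. W. S. Cassels, A. Fröhlich (eds.), *Algebraic Number Theory* (1967), Ch. XV (Tate) §4.3–§4.4, Thm. 4.4.1.
* [Tate1950] J. Tate, *Fourier analysis in number fields and Hecke's zeta-functions* (1950), §2.4–§2.5, §4.4.
* [JacquetLanglands1970] H. Jacquet, R. P. Langlands, *Automorphic forms on GL(2)*, LNM 114 (1970), §11 p. 171.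
* [NeukirchANT1999] J. Neukirch, *Algebraic Number Theory* (1999), Ch. VII (5.2) (the Euler product of `ζ_K` on `re > 1`).
-/

set_option autoImplicit false
set_option linter.dupNamespace false -- the mandated namespace repeats `HodgeConjecture.HodgeConjecture`

noncomputable section

open MeasureTheory Measure NumberField NumberField.mixedEmbedding IsDedekindDomain Set Filter Topology
open scoped NNReal ENNReal Classical
open Literature.NumberTheory
open Literature.NumberTheory.GaloisRepresentations (ideleGroup)
open Literature.NumberTheory.GaloisRepresentations.IsNonarchimedeanLocalField
open Literature.NumberTheory.Automorphic
open Summit.HodgeConjecture.HodgeConjecture.Cruxes.H413.F0P2wPartialDedekindZetaPole (hasProd_partialDedekindZeta)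

namespace Summit.HodgeConjecture.HodgeConjecture.Cruxes.HLiu418.K2LiuIdelicUnramifiedZetaProduct

variable {K : Type} [Field K] [NumberField K]

/-! ## §0 Integrability of the local functions -/

section Local

variable (v : HeightOneSpectrum (𝓞 K)) [MeasurableSpace (v.adicCompletion K)] [BorelSpace (v.adicCompletion K)]

/-- **`𝟙_{𝒪_v∖0}(y)|y|_v^w` is integrable on `K_vˣ` for `0 < re w`** and a left-invariant measure finite on compacts
(★ Tate `integrable_units_of_norm_le`: `|𝟙_{𝔭^0}(y)|y|^w| = 𝟙_{𝔭^0}(y)|y|^{re w}`). [cite: Tate1950, §2.4 Lemma 2.4.1, §2.5] -/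
theorem integrable_indicator_integers_mul_cpow (μv : Measure (v.adicCompletion K)ˣ) [IsFiniteMeasureOnCompacts μv] [μv.IsMulLeftInvariant]
    {w : ℂ} (hw : 0 < w.re) :
    Integrable (fun y : (v.adicCompletion K)ˣ =>
      {y : (v.adicCompletion K)ˣ | Valued.v (y : v.adicCompletion K) ≤ 1}.indicator (fun _ => (1 : ℂ)) y *
        (((normAbs (v.adicCompletion K) (y : v.adicCompletion K) : ℝ≥0) : ℝ) : ℂ) ^ w) μv := by
  haveI : BorelSpace (v.adicCompletion K)ˣ := Units.borelSpace
  have hset : {y : (v.adicCompletion K)ˣ | Valued.v (y : v.adicCompletion K) ≤ 1} =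
      {y : (v.adicCompletion K)ˣ | (y : v.adicCompletion K) ∈ primePowBall (v.adicCompletion K) 0} := by
    ext y
    exact K2LiuIdelicEulerLimit.valued_le_one_iff_mem_primePowBall v _
  have hmeas : MeasurableSet {y : (v.adicCompletion K)ˣ | Valued.v (y : v.adicCompletion K) ≤ 1} := by
    rw [hset]
    exact measurableSet_units_mem_primePowBall 0
  refine integrable_units_of_norm_le μv ?_ 0 hw 1 fun y => ?_
  · exact ((measurable_const.indicator hmeas).mul
      (isLocallyConstant_normAbs_cpow w).continuous.measurable).aestronglyMeasurable
  · rw [one_mul, ← hset]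
    have hpos : (0 : ℝ) < ((normAbs (v.adicCompletion K) (y : v.adicCompletion K) : ℝ≥0) : ℝ) :=
      NNReal.coe_pos.2 (pos_iff_ne_zero.2 ((map_ne_zero (normAbs (v.adicCompletion K))).2 y.ne_zero))
    by_cases hy : y ∈ {y : (v.adicCompletion K)ˣ | Valued.v (y : v.adicCompletion K) ≤ 1}
    · rw [Set.indicator_of_mem hy, Set.indicator_of_mem hy, one_mul, Complex.norm_cpow_eq_rpow_re_of_pos hpos]
    · rw [Set.indicator_of_notMem hy, Set.indicator_of_notMem hy, zero_mul, norm_zero]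

/-- **`𝟙_{𝒪_vˣ}(y)|y|_v^w` is integrable** for a measure finite on compacts (it IS the indicator of the compact open `𝒪_vˣ`). [folklore] -/
theorem integrable_indicator_units_mul_cpow (μv : Measure (v.adicCompletion K)ˣ) [IsFiniteMeasureOnCompacts μv] (w : ℂ) :
    Integrable (fun y : (v.adicCompletion K)ˣ =>
      {y : (v.adicCompletion K)ˣ | Valued.v (y : v.adicCompletion K) = 1}.indicator (fun _ => (1 : ℂ)) y *
        (((normAbs (v.adicCompletion K) (y : v.adicCompletion K) : ℝ≥0) : ℝ) : ℂ) ^ w) μv := by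
  haveI : BorelSpace (v.adicCompletion K)ˣ := Units.borelSpace
  have h : (fun y : (v.adicCompletion K)ˣ =>
      {y : (v.adicCompletion K)ˣ | Valued.v (y : v.adicCompletion K) = 1}.indicator (fun _ => (1 : ℂ)) y *
        (((normAbs (v.adicCompletion K) (y : v.adicCompletion K) : ℝ≥0) : ℝ) : ℂ) ^ w) =
      {y : (v.adicCompletion K)ˣ | Valued.v (y : v.adicCompletion K) = 1}.indicator (fun _ => (1 : ℂ)) := by
    funext y
    by_cases hy : y ∈ {y : (v.adicCompletion K)ˣ | Valued.v (y : v.adicCompletion K) = 1}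
    · rw [Set.indicator_of_mem hy, K2LiuIdelicEulerLimit.normAbs_eq_one_of_valued_eq_one v hy, NNReal.coe_one,
        Complex.ofReal_one, Complex.one_cpow, one_mul]
    · rw [Set.indicator_of_notMem hy, zero_mul]
  rw [h]
  exact (integrableOn_const (measure_units_valued_eq_one_ne_top v μv)).integrable_indicator (measurableSet_units_valued_eq_one v)

end Local

/-! ## §1 The integrand on a box `B(S'ᶜ)`, `S ⊆ S'` -/

section Pointwise

/-- **`𝟙_D(a) = ∏_{v∈S'} 𝟙_{E_v}(a_v)` on the box `B(S'ᶜ)`, `S ⊆ S'`** (`E_v = 𝒪_vˣ` for `v ∈ S`, `𝒪_v ∖ 0` for `v ∉ S`; off `S'` every coordinate of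
`a` is a unit, so the conditions of `D` there are automatic). [folklore] -/
theorem indicator_shellSet_eq_prod_of_mem_ideleUnitBox {S S' : Finset (HeightOneSpectrum (𝓞 K))} (hSS' : S ⊆ S') {a : ideleGroup K}
    (ha : a ∈ ideleUnitBox (K := K) {w | w ∉ S'}) :
    {a : ideleGroup K | (∀ v ∈ S, Valued.v (((a : ideleGroup K) : AdeleRing (𝓞 K) K).2 v) = 1) ∧
        ∀ v, v ∉ S → Valued.v (((a : ideleGroup K) : AdeleRing (𝓞 K) K).2 v) ≤ 1}.indicator (fun _ => (1 : ℂ)) a =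
      ∏ v ∈ S', (if v ∈ S then {y : (v.adicCompletion K)ˣ | Valued.v (y : v.adicCompletion K) = 1}
          else {y : (v.adicCompletion K)ˣ | Valued.v (y : v.adicCompletion K) ≤ 1}).indicator (fun _ => (1 : ℂ))
        ((GaloisRepresentations.ideleGroup.finComp (K := K) v).toHomUnits a) := by
  by_cases hD : a ∈ {a : ideleGroup K | (∀ v ∈ S, Valued.v (((a : ideleGroup K) : AdeleRing (𝓞 K) K).2 v) = 1) ∧
      ∀ v, v ∉ S → Valued.v (((a : ideleGroup K) : AdeleRing (𝓞 K) K).2 v) ≤ 1}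
  · rw [Set.indicator_of_mem hD]
    symm
    refine Finset.prod_eq_one fun v _ => ?_
    by_cases hvS : v ∈ S
    · rw [if_pos hvS, Set.indicator_of_mem]
      exact hD.1 v hvS
    · rw [if_neg hvS, Set.indicator_of_mem]
      exact hD.2 v hvS
  · rw [Set.indicator_of_notMem hD]
    symm
    by_contra hne
    refine hD ⟨fun v hvS => ?_, fun v hvS => ?_⟩
    · by_contra hv
      exact hne (Finset.prod_eq_zero (hSS' hvS) (by rw [if_pos hvS, Set.indicator_of_notMem]; exact hv))
    · by_cases hvS' : v ∈ S'
      · by_contra hv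
        exact hne (Finset.prod_eq_zero hvS' (by rw [if_neg hvS, Set.indicator_of_notMem]; exact hv))
      · exact le_of_eq (ha v hvS')

/-- **The integrand on the box**: for `a ∈ B(S'ᶜ)`, `S ⊆ S'`,
`g(a_∞)·𝟙_D(a)·|a|^w = [g(a_∞) N(a_∞)^w] · ∏_{v∈S'} 𝟙_{E_v}(a_v)|a_v|_v^w` (★ `ideleNorm_cpow_eq_of_mem_ideleUnitBox`).
[cite: CasselsFrohlichANT1967, Ch. XV §4.3] -/
theorem integrand_eq_mul_prod_of_mem_ideleUnitBox {S S' : Finset (HeightOneSpectrum (𝓞 K))} (hSS' : S ⊆ S')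
    (g : (mixedSpace K)ˣ → ℂ) (w : ℂ) {a : ideleGroup K} (ha : a ∈ ideleUnitBox (K := K) {w | w ∉ S'}) :
    g (archUnitsOfIdele K a) *
        {a : ideleGroup K | (∀ v ∈ S, Valued.v (((a : ideleGroup K) : AdeleRing (𝓞 K) K).2 v) = 1) ∧
          ∀ v, v ∉ S → Valued.v (((a : ideleGroup K) : AdeleRing (𝓞 K) K).2 v) ≤ 1}.indicator (fun _ => (1 : ℂ)) a *
        ((IdeleClassGroup.ideleNorm K a : ℝ) : ℂ) ^ w =
      (g (archUnitsOfIdele K a) * ((mixedEmbedding.norm ((archUnitsOfIdele K a : (mixedSpace K)ˣ) : mixedSpace K) : ℝ) : ℂ) ^ w) *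
        ∏ v ∈ S', ((if v ∈ S then {y : (v.adicCompletion K)ˣ | Valued.v (y : v.adicCompletion K) = 1}
            else {y : (v.adicCompletion K)ˣ | Valued.v (y : v.adicCompletion K) ≤ 1}).indicator (fun _ => (1 : ℂ))
            ((GaloisRepresentations.ideleGroup.finComp (K := K) v).toHomUnits a) *
          (((normAbs (v.adicCompletion K) (((GaloisRepresentations.ideleGroup.finComp (K := K) v).toHomUnits a :
            (v.adicCompletion K)ˣ) : v.adicCompletion K) : ℝ≥0) : ℝ) : ℂ) ^ w) := by
  rw [indicator_shellSet_eq_prod_of_mem_ideleUnitBox hSS' ha, ideleNorm_cpow_eq_of_mem_ideleUnitBox ha w, Finset.prod_mul_distrib]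
  ring

/-- **`D` is open** (★ `isOpen_setOf_forall_valued_snd_eq_one` ∩ ★ `isOpen_setOf_forall_valued_snd_le_one`), hence Borel measurable. [folklore] -/
theorem isOpen_shellSet (S : Finset (HeightOneSpectrum (𝓞 K))) :
    IsOpen {a : ideleGroup K | (∀ v ∈ S, Valued.v (((a : ideleGroup K) : AdeleRing (𝓞 K) K).2 v) = 1) ∧
      ∀ v, v ∉ S → Valued.v (((a : ideleGroup K) : AdeleRing (𝓞 K) K).2 v) ≤ 1} := by
  have heq : {a : ideleGroup K | (∀ v ∈ S, Valued.v (((a : ideleGroup K) : AdeleRing (𝓞 K) K).2 v) = 1) ∧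
      ∀ v, v ∉ S → Valued.v (((a : ideleGroup K) : AdeleRing (𝓞 K) K).2 v) ≤ 1} =
      {x : ideleGroup K | ∀ w ∈ (↑S : Set (HeightOneSpectrum (𝓞 K))), Valued.v ((x : AdeleRing (𝓞 K) K).2 w) = 1} ∩
        {x : ideleGroup K | ∀ w ∈ ((↑S : Set (HeightOneSpectrum (𝓞 K)))ᶜ), Valued.v ((x : AdeleRing (𝓞 K) K).2 w) ≤ 1} := by
    ext a
    simp only [Set.mem_setOf_eq, Set.mem_inter_iff, Finset.mem_coe, Set.mem_compl_iff]
  rw [heq]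
  exact (isOpen_setOf_forall_valued_snd_eq_one _).inter (isOpen_setOf_forall_valued_snd_le_one _)

end Pointwise

/-! ## §2 The box identity and the integrability on `𝕀_K`; §3 the Euler product -/

section Box

variable [MeasurableSpace (ideleGroup K)] [BorelSpace (ideleGroup K)]
  [MeasurableSpace ((mixedSpace K)ˣ)] [BorelSpace ((mixedSpace K)ˣ)]
  [∀ v : HeightOneSpectrum (𝓞 K), MeasurableSpace (v.adicCompletion K)] [∀ v : HeightOneSpectrum (𝓞 K), BorelSpace (v.adicCompletion K)]

/-- **THE BOX IDENTITY.**  With the splitting constant `c = c_S` of `ν|_{B(Sᶜ)}` against `μ_∞ ⊗ ⊗_{v∈S} μ_v` (`hc`), `0 < re w` and `g N^w ∈ L¹(μ_∞)`, for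
every finite set `T` of places outside `S`:
  `∫_{B((S ∪ T)ᶜ)} g(a_∞) 𝟙_D(a) |a|^w dν = c · (∫ g N^w dμ_∞) · (∏_{v∈S} μ_v(𝒪_vˣ)) · ∏_{t∈T} (1 − q_t^{−w})⁻¹`
(splitting of `ν|_{B((S∪T)ᶜ)}` ★ `exists_splittingConst_ideleUnitBox_compl`, local factors ★ part 1, constants ★ `splittingConst_eq_mul_prod_of_subset`).
[cite: CasselsFrohlichANT1967, Ch. XV §4.4 Thm. 4.4.1] [cite: Tate1950, §2.5] -/
theorem setIntegral_ideleUnitBox_union_eq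
    (ν : Measure (ideleGroup K)) [IsFiniteMeasureOnCompacts ν] [ν.IsMulLeftInvariant]
    (μinf : Measure (mixedSpace K)ˣ) [IsHaarMeasure μinf]
    (μv : ∀ v : HeightOneSpectrum (𝓞 K), Measure (v.adicCompletion K)ˣ) [∀ v, IsHaarMeasure (μv v)]
    (S : Finset (HeightOneSpectrum (𝓞 K))) {c : ℝ≥0}
    (hc : (ν.restrict (ideleUnitBox (K := K) {w | w ∉ S})).map
        (fun a : ideleGroup K => (archUnitsOfIdele K a,
          fun v : ↥S => (GaloisRepresentations.ideleGroup.finComp v.1).toHomUnits a)) =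
      c • (μinf.prod (Measure.pi fun v : ↥S => μv v.1)))
    {w : ℂ} (hw : 0 < w.re) {g : (mixedSpace K)ˣ → ℂ}
    (hg : Integrable (fun x : (mixedSpace K)ˣ => g x * ((mixedEmbedding.norm ((x : (mixedSpace K)ˣ) : mixedSpace K) : ℝ) : ℂ) ^ w) μinf)
    (T : Finset {v : HeightOneSpectrum (𝓞 K) // v ∉ S}) :
    ∫ a in ideleUnitBox (K := K) {w | w ∉ S ∪ T.map (Function.Embedding.subtype fun v => v ∉ S)},
        g (archUnitsOfIdele K a) *
          {a : ideleGroup K | (∀ v ∈ S, Valued.v (((a : ideleGroup K) : AdeleRing (𝓞 K) K).2 v) = 1) ∧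
            ∀ v, v ∉ S → Valued.v (((a : ideleGroup K) : AdeleRing (𝓞 K) K).2 v) ≤ 1}.indicator (fun _ => (1 : ℂ)) a *
          ((IdeleClassGroup.ideleNorm K a : ℝ) : ℂ) ^ w ∂ν =
      (c : ℂ) * (∫ x : (mixedSpace K)ˣ, g x * ((mixedEmbedding.norm ((x : (mixedSpace K)ˣ) : mixedSpace K) : ℝ) : ℂ) ^ w ∂μinf) *
        (∏ v ∈ S, ((μv v).real {y : (v.adicCompletion K)ˣ | Valued.v (y : v.adicCompletion K) = 1} : ℂ)) *
        ∏ t ∈ T, (1 - (t.1.residueCard : ℂ) ^ (-w))⁻¹ := by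
  haveI : ∀ v : HeightOneSpectrum (𝓞 K), BorelSpace ((v.adicCompletion K)ˣ) := fun v => Units.borelSpace
  set emb : {v : HeightOneSpectrum (𝓞 K) // v ∉ S} ↪ HeightOneSpectrum (𝓞 K) :=
    Function.Embedding.subtype fun v => v ∉ S with hemb
  set S' : Finset (HeightOneSpectrum (𝓞 K)) := S ∪ T.map emb with hS'
  have hSS' : S ⊆ S' := Finset.subset_union_left
  have hdisj : Disjoint S (T.map emb) := disjoint_map_subtype S T
  have hsdiff : S' \ S = T.map emb := Finset.union_sdiff_cancel_left hdisj
  -- the local functions `h_v = 𝟙_{E_v} |·|_v^w`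
  set h : ∀ v : HeightOneSpectrum (𝓞 K), (v.adicCompletion K)ˣ → ℂ := fun v y =>
    (if v ∈ S then {y : (v.adicCompletion K)ˣ | Valued.v (y : v.adicCompletion K) = 1}
      else {y : (v.adicCompletion K)ˣ | Valued.v (y : v.adicCompletion K) ≤ 1}).indicator (fun _ => (1 : ℂ)) y *
      (((normAbs (v.adicCompletion K) (y : v.adicCompletion K) : ℝ≥0) : ℝ) : ℂ) ^ w with hh
  have hhi : ∀ v, Integrable (h v) (μv v) := by
    intro v
    by_cases hvS : v ∈ S
    · simp only [hh, if_pos hvS]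
      exact integrable_indicator_units_mul_cpow v (μv v) w
    · simp only [hh, if_neg hvS]
      exact integrable_indicator_integers_mul_cpow v (μv v) hw
  -- the splitting of `ν|_{B(S'ᶜ)}`
  obtain ⟨c', hc', hsplit'⟩ := exists_splittingConst_ideleUnitBox_compl ν μinf μv S'
  have hval : ∫ a in ideleUnitBox (K := K) {w | w ∉ S'},
      (g (archUnitsOfIdele K a) * ((mixedEmbedding.norm ((archUnitsOfIdele K a : (mixedSpace K)ˣ) : mixedSpace K) : ℝ) : ℂ) ^ w) *
        ∏ v : ↥S', h v.1 ((GaloisRepresentations.ideleGroup.finComp (K := K) v.1).toHomUnits a) ∂ν =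
      (c' : ℂ) * (∫ x : (mixedSpace K)ˣ, g x * ((mixedEmbedding.norm ((x : (mixedSpace K)ˣ) : mixedSpace K) : ℝ) : ℂ) ^ w ∂μinf) *
        ∏ v : ↥S', ∫ y, h v.1 y ∂(μv v.1) :=
    (hsplit' _ (fun v : ↥S' => h v.1) hg fun v => hhi v.1).2
  -- rewrite the integrand on the box
  have hBm : MeasurableSet (ideleUnitBox (K := K) {w | w ∉ S'}) := measurableSet_ideleUnitBox_compl' S'
  have hpt : ∀ a ∈ ideleUnitBox (K := K) {w | w ∉ S'},
      g (archUnitsOfIdele K a) *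
          {a : ideleGroup K | (∀ v ∈ S, Valued.v (((a : ideleGroup K) : AdeleRing (𝓞 K) K).2 v) = 1) ∧
            ∀ v, v ∉ S → Valued.v (((a : ideleGroup K) : AdeleRing (𝓞 K) K).2 v) ≤ 1}.indicator (fun _ => (1 : ℂ)) a *
          ((IdeleClassGroup.ideleNorm K a : ℝ) : ℂ) ^ w =
        (g (archUnitsOfIdele K a) * ((mixedEmbedding.norm ((archUnitsOfIdele K a : (mixedSpace K)ˣ) : mixedSpace K) : ℝ) : ℂ) ^ w) *
          ∏ v : ↥S', h v.1 ((GaloisRepresentations.ideleGroup.finComp (K := K) v.1).toHomUnits a) := by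
    intro a ha
    rw [integrand_eq_mul_prod_of_mem_ideleUnitBox hSS' g w ha, ← Finset.prod_coe_sort S']
  rw [setIntegral_congr_fun hBm hpt, hval, Finset.prod_coe_sort S' fun v => ∫ y, h v y ∂(μv v)]
  -- split the product of local integrals over `S' = S ⊔ T` and evaluate
  rw [Finset.prod_union hdisj, Finset.prod_map]
  have hSloc : ∀ v ∈ S, ∫ y, h v y ∂(μv v) = ((μv v).real {y : (v.adicCompletion K)ˣ | Valued.v (y : v.adicCompletion K) = 1} : ℂ) := by
    intro v hvS
    simp only [hh, if_pos hvS]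
    exact K2LiuIdelicEulerLimit.integral_indicator_units_mul_cpow v (μv v) w
  have hTloc : ∀ t ∈ T, ∫ y, h (emb t) y ∂(μv (emb t)) =
      ((μv t.1).real {y : (t.1.adicCompletion K)ˣ | Valued.v (y : t.1.adicCompletion K) = 1} : ℂ) * (1 - (t.1.residueCard : ℂ) ^ (-w))⁻¹ := by
    intro t _
    change ∫ y, h t.1 y ∂(μv t.1) = _
    simp only [hh, if_neg t.2]
    exact K2LiuIdelicEulerLimit.integral_indicator_integers_mul_cpow t.1 (μv t.1) hw
  rw [Finset.prod_congr rfl hSloc, Finset.prod_congr rfl hTloc, Finset.prod_mul_distrib]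
  -- the constants: `c = c' ∏_{t∈T} μ_t(𝒪_tˣ)`
  have hcc' : (c : ℂ) = (c' : ℂ) * ∏ t ∈ T, ((μv t.1).real {y : (t.1.adicCompletion K)ˣ | Valued.v (y : t.1.adicCompletion K) = 1} : ℂ) := by
    have h1 := splittingConst_eq_mul_prod_of_subset ν μinf μv hSS' hc hc'
    rw [hsdiff, Finset.prod_map] at h1
    have h2 := congrArg ENNReal.toReal h1
    rw [ENNReal.coe_toReal, ENNReal.toReal_mul, ENNReal.coe_toReal, ENNReal.toReal_prod] at h2
    have h3 := congrArg (fun r : ℝ => (r : ℂ)) h2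
    simp only [Complex.ofReal_mul, Complex.ofReal_prod] at h3
    exact h3
  rw [hcc']
  ring

/-- **INTEGRABILITY on `𝕀_K`**: for `1 < re w`, `g` measurable with `g N^w ∈ L¹(μ_∞)`, the integrand `g(a_∞) 𝟙_D(a) |a|^w` is `ν`-integrable: on `B(S'ᶜ)` its norm
is `|g N^w|(a_∞) ∏_{v∈S'} |h_v(a_v)|` with `∫|h_t| = μ_t(𝒪_tˣ) ζ_t(re w) = μ_t(𝒪_tˣ)(1 + a_t)`, `a_t = ζ_t(re w) − 1 ≤ q_t^{−re w}∕(1 − 2^{−re w})` summable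
(★ `integrable_of_norm_eq_mul_prod_on_ideleUnitBox`, ★ `summable_residueCard_rpow_neg`). [cite: JacquetLanglands1970, §11 p. 172] [cite: NeukirchANT1999, Ch. VII (5.2)] -/
theorem integrable_arch_mul_indicator_mul_ideleNorm_cpow
    (ν : Measure (ideleGroup K)) [IsFiniteMeasureOnCompacts ν] [ν.IsMulLeftInvariant]
    (μinf : Measure (mixedSpace K)ˣ) [IsHaarMeasure μinf]
    (μv : ∀ v : HeightOneSpectrum (𝓞 K), Measure (v.adicCompletion K)ˣ) [∀ v, IsHaarMeasure (μv v)]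
    (S : Finset (HeightOneSpectrum (𝓞 K))) {w : ℂ} (hw : 1 < w.re) {g : (mixedSpace K)ˣ → ℂ} (hgm : Measurable g)
    (hg : Integrable (fun x : (mixedSpace K)ˣ => g x * ((mixedEmbedding.norm ((x : (mixedSpace K)ˣ) : mixedSpace K) : ℝ) : ℂ) ^ w) μinf) :
    Integrable (fun a : ideleGroup K => g (archUnitsOfIdele K a) *
      {a : ideleGroup K | (∀ v ∈ S, Valued.v (((a : ideleGroup K) : AdeleRing (𝓞 K) K).2 v) = 1) ∧
        ∀ v, v ∉ S → Valued.v (((a : ideleGroup K) : AdeleRing (𝓞 K) K).2 v) ≤ 1}.indicator (fun _ => (1 : ℂ)) a *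
      ((IdeleClassGroup.ideleNorm K a : ℝ) : ℂ) ^ w) ν := by
  haveI : ∀ v : HeightOneSpectrum (𝓞 K), BorelSpace ((v.adicCompletion K)ˣ) := fun v => Units.borelSpace
  have hw0 : 0 < w.re := by linarith
  -- measurability of `g(a_∞)` and of `|a|^w`
  have h1 : Measurable fun a : ideleGroup K => g (archUnitsOfIdele K a) := hgm.comp continuous_archUnitsOfIdele.measurable
  have h2 : Measurable fun a : ideleGroup K => ((IdeleClassGroup.ideleNorm K a : ℝ) : ℂ) ^ w :=
    (Complex.measurable_ofReal.comp (NNReal.continuous_coe.measurable.comp (continuous_ideleNorm_holds K).measurable)).pow_const w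
  -- the local functions and their deviations
  have hq : ∀ t : HeightOneSpectrum (𝓞 K), (2 : ℝ) ≤ t.residueCard := fun t => by exact_mod_cast t.one_lt_residueCard
  have hx0 : ∀ t : HeightOneSpectrum (𝓞 K), 0 < (t.residueCard : ℝ) ^ (-w.re) := fun t =>
    Real.rpow_pos_of_pos (by linarith [hq t]) _
  have h21 : (2 : ℝ) ^ (-w.re) < 1 := Real.rpow_lt_one_of_one_lt_of_neg (by norm_num) (by linarith)
  have hx1 : ∀ t : HeightOneSpectrum (𝓞 K), (t.residueCard : ℝ) ^ (-w.re) ≤ (2 : ℝ) ^ (-w.re) := fun t =>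
    Real.rpow_le_rpow_of_nonpos (by norm_num) (hq t) (by linarith)
  have hx1' : ∀ t : HeightOneSpectrum (𝓞 K), (t.residueCard : ℝ) ^ (-w.re) < 1 := fun t => lt_of_le_of_lt (hx1 t) h21
  have ha0 : ∀ t : HeightOneSpectrum (𝓞 K), 0 ≤ (1 - (t.residueCard : ℝ) ^ (-w.re))⁻¹ - 1 := fun t =>
    sub_nonneg.2 ((one_le_inv₀ (sub_pos.2 (hx1' t))).2 (sub_le_self _ (hx0 t).le))
  have hale : ∀ t : HeightOneSpectrum (𝓞 K), (1 - (t.residueCard : ℝ) ^ (-w.re))⁻¹ - 1 ≤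
      (1 - (2 : ℝ) ^ (-w.re))⁻¹ * (t.residueCard : ℝ) ^ (-w.re) := by
    intro t
    have hne : (1 - (t.residueCard : ℝ) ^ (-w.re)) ≠ 0 := (sub_pos.2 (hx1' t)).ne'
    have heq : (1 - (t.residueCard : ℝ) ^ (-w.re))⁻¹ - 1 = (t.residueCard : ℝ) ^ (-w.re) / (1 - (t.residueCard : ℝ) ^ (-w.re)) := by
      field_simp
      ring
    rw [heq, mul_comm, ← div_eq_mul_inv]
    exact div_le_div_of_nonneg_left (hx0 t).le (sub_pos.2 h21) (sub_le_sub_left (hx1 t) 1)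
  have hsum : Summable fun t : HeightOneSpectrum (𝓞 K) => (1 - (t.residueCard : ℝ) ^ (-w.re))⁻¹ - 1 :=
    Summable.of_nonneg_of_le ha0 hale ((summable_residueCard_rpow_neg hw).mul_left _)
  refine integrable_of_norm_eq_mul_prod_on_ideleUnitBox ν μinf μv
    ((h1.mul (measurable_const.indicator (isOpen_shellSet S).measurableSet)).mul h2).aestronglyMeasurable hg
    (h := fun v y => (if v ∈ S then {y : (v.adicCompletion K)ˣ | Valued.v (y : v.adicCompletion K) = 1}
      else {y : (v.adicCompletion K)ˣ | Valued.v (y : v.adicCompletion K) ≤ 1}).indicator (fun _ => (1 : ℂ)) y *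
      (((normAbs (v.adicCompletion K) (y : v.adicCompletion K) : ℝ≥0) : ℝ) : ℂ) ^ w)
    (fun v => ?_) S (k := fun _ => (1 : ℝ)) (fun _ => zero_le_one) (ℓ := fun _ => (1 : ℝ)) (fun S' _ => by simp)
    (fun S' hSS' a ha => ?_) ha0 hsum (fun t ht => ?_)
  · -- integrability of the local functions
    by_cases hvS : v ∈ S
    · simp only [if_pos hvS]
      exact integrable_indicator_units_mul_cpow v (μv v) w
    · simp only [if_neg hvS]
      exact integrable_indicator_integers_mul_cpow v (μv v) hw0
  · -- the factorisation of the norm on `B(S'ᶜ)`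
    rw [integrand_eq_mul_prod_of_mem_ideleUnitBox hSS' g w ha, one_mul, norm_mul, norm_prod]
  · -- the local deviation off `S`
    simp only [if_neg ht]
    rw [K2LiuIdelicEulerLimit.integral_norm_indicator_integers_mul_cpow t (μv t) hw0, mul_one]
    have : (1 : ℝ) + ((1 - (t.residueCard : ℝ) ^ (-w.re))⁻¹ - 1) = (1 - (t.residueCard : ℝ) ^ (-w.re))⁻¹ := by ring
    rw [this]
    rfl

/-! ## §3 MAIN: the unramified idelic zeta product -/

/-- **MAIN. `∫_{𝕀_K} g(a_∞) 𝟙_D(a) |a|^w dν(a) = c_S · (∫ g N^w dμ_∞) · (∏_{v∈S} μ_v(𝒪_vˣ)) · ζ_K^S(w)`** for `1 < re w`, `g` measurable with `g N^w ∈ L¹(μ_∞)`,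
`D = {|a_v|_v = 1 (v ∈ S), |a_v|_v ≤ 1 (v ∉ S)}`, `c_S` the splitting constant of `hc`, `ζ_K^S(w) = partialStandardL S 1 w = ∏_{v∉S} (1 − q_v^{−w})⁻¹`: both sides
are the limit over the boxes `B((S ∪ T)ᶜ)` (★ part 1 `integral_eq_mul_of_forall_setIntegral_box_eq`, `setIntegral_ideleUnitBox_union_eq`, ★ `hasProd_partialDedekindZeta`).
This is THE idelic coefficient of the Godement section of a flat section spherical off `S` ((β4-iii)), and the template for every «unramified Euler factor
of an idelic integral». [cite: CasselsFrohlichANT1967, Ch. XV §4.4 Thm. 4.4.1] [cite: Tate1950, §4.4] [cite: NeukirchANT1999, Ch. VII (5.2)] -/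
theorem integral_arch_mul_indicator_mul_ideleNorm_cpow_eq
    (ν : Measure (ideleGroup K)) [IsFiniteMeasureOnCompacts ν] [ν.IsMulLeftInvariant]
    (μinf : Measure (mixedSpace K)ˣ) [IsHaarMeasure μinf]
    (μv : ∀ v : HeightOneSpectrum (𝓞 K), Measure (v.adicCompletion K)ˣ) [∀ v, IsHaarMeasure (μv v)]
    (S : Finset (HeightOneSpectrum (𝓞 K))) {c : ℝ≥0}
    (hc : (ν.restrict (ideleUnitBox (K := K) {w | w ∉ S})).map
        (fun a : ideleGroup K => (archUnitsOfIdele K a,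
          fun v : ↥S => (GaloisRepresentations.ideleGroup.finComp v.1).toHomUnits a)) =
      c • (μinf.prod (Measure.pi fun v : ↥S => μv v.1)))
    {w : ℂ} (hw : 1 < w.re) {g : (mixedSpace K)ˣ → ℂ} (hgm : Measurable g)
    (hg : Integrable (fun x : (mixedSpace K)ˣ => g x * ((mixedEmbedding.norm ((x : (mixedSpace K)ˣ) : mixedSpace K) : ℝ) : ℂ) ^ w) μinf) :
    ∫ a, g (archUnitsOfIdele K a) *
          {a : ideleGroup K | (∀ v ∈ S, Valued.v (((a : ideleGroup K) : AdeleRing (𝓞 K) K).2 v) = 1) ∧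
            ∀ v, v ∉ S → Valued.v (((a : ideleGroup K) : AdeleRing (𝓞 K) K).2 v) ≤ 1}.indicator (fun _ => (1 : ℂ)) a *
          ((IdeleClassGroup.ideleNorm K a : ℝ) : ℂ) ^ w ∂ν =
      (c : ℂ) * (∫ x : (mixedSpace K)ˣ, g x * ((mixedEmbedding.norm ((x : (mixedSpace K)ˣ) : mixedSpace K) : ℝ) : ℂ) ^ w ∂μinf) *
        (∏ v ∈ S, ((μv v).real {y : (v.adicCompletion K)ˣ | Valued.v (y : v.adicCompletion K) = 1} : ℂ)) *
        partialStandardL (↑S : Set (HeightOneSpectrum (𝓞 K))) (fun _ => ({1} : Multiset ℂ)) w := by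
  have hw0 : 0 < w.re := by linarith
  exact K2LiuIdelicEulerLimit.integral_eq_mul_of_forall_setIntegral_box_eq ν
    (integrable_arch_mul_indicator_mul_ideleNorm_cpow ν μinf μv S hw hgm hg) S _
    (hasProd_partialDedekindZeta (S := (↑S : Set (HeightOneSpectrum (𝓞 K)))) hw).1
    (fun T => setIntegral_ideleUnitBox_union_eq ν μinf μv S hc hw0 hg T)

/-- **MAIN, packaged for a Haar measure `ν` on `𝕀_K`**: there is ONE constant `c_S ≠ 0` (the splitting constant of `ν|_{B(Sᶜ)}` against
`μ_∞ ⊗ ⊗_{v∈S} μ_v`, ★ `exists_splittingConst_ideleUnitBox_compl`, non-zero by ★ `ne_zero_of_map_restrict_ideleUnitBox_compl_eq_smul`) such that for EVERY `w` with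
`1 < re w` and EVERY measurable `g` with `g N^w ∈ L¹(μ_∞)` the integrand `g(a_∞) 𝟙_D(a) |a|^w` is integrable and
`∫_{𝕀_K} g(a_∞) 𝟙_D(a) |a|^w dν = c_S · (∫ g N^w dμ_∞) · (∏_{v∈S} μ_v(𝒪_vˣ)) · ζ_K^S(w)`. [cite: CasselsFrohlichANT1967, Ch. XV §4.4 Thm. 4.4.1] [cite: Tate1950, §4.4] -/
theorem exists_integral_arch_mul_indicator_mul_ideleNorm_cpow_eq
    (ν : Measure (ideleGroup K)) [ν.IsHaarMeasure]
    (μinf : Measure (mixedSpace K)ˣ) [IsHaarMeasure μinf]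
    (μv : ∀ v : HeightOneSpectrum (𝓞 K), Measure (v.adicCompletion K)ˣ) [∀ v, IsHaarMeasure (μv v)]
    (S : Finset (HeightOneSpectrum (𝓞 K))) :
    ∃ c : ℝ≥0, c ≠ 0 ∧ ∀ (w : ℂ), 1 < w.re → ∀ (g : (mixedSpace K)ˣ → ℂ), Measurable g →
      Integrable (fun x : (mixedSpace K)ˣ => g x * ((mixedEmbedding.norm ((x : (mixedSpace K)ˣ) : mixedSpace K) : ℝ) : ℂ) ^ w) μinf →
      Integrable (fun a : ideleGroup K => g (archUnitsOfIdele K a) *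
          {a : ideleGroup K | (∀ v ∈ S, Valued.v (((a : ideleGroup K) : AdeleRing (𝓞 K) K).2 v) = 1) ∧
            ∀ v, v ∉ S → Valued.v (((a : ideleGroup K) : AdeleRing (𝓞 K) K).2 v) ≤ 1}.indicator (fun _ => (1 : ℂ)) a *
          ((IdeleClassGroup.ideleNorm K a : ℝ) : ℂ) ^ w) ν ∧
        ∫ a, g (archUnitsOfIdele K a) *
            {a : ideleGroup K | (∀ v ∈ S, Valued.v (((a : ideleGroup K) : AdeleRing (𝓞 K) K).2 v) = 1) ∧
              ∀ v, v ∉ S → Valued.v (((a : ideleGroup K) : AdeleRing (𝓞 K) K).2 v) ≤ 1}.indicator (fun _ => (1 : ℂ)) a *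
            ((IdeleClassGroup.ideleNorm K a : ℝ) : ℂ) ^ w ∂ν =
          (c : ℂ) * (∫ x : (mixedSpace K)ˣ, g x * ((mixedEmbedding.norm ((x : (mixedSpace K)ˣ) : mixedSpace K) : ℝ) : ℂ) ^ w ∂μinf) *
            (∏ v ∈ S, ((μv v).real {y : (v.adicCompletion K)ˣ | Valued.v (y : v.adicCompletion K) = 1} : ℂ)) *
            partialStandardL (↑S : Set (HeightOneSpectrum (𝓞 K))) (fun _ => ({1} : Multiset ℂ)) w := by
  haveI : ∀ v : HeightOneSpectrum (𝓞 K), BorelSpace ((v.adicCompletion K)ˣ) := fun v => Units.borelSpace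
  obtain ⟨c, hc, -⟩ := exists_splittingConst_ideleUnitBox_compl ν μinf μv S
  exact ⟨c, ne_zero_of_map_restrict_ideleUnitBox_compl_eq_smul ν S _ hc, fun w hw g hgm hg =>
    ⟨integrable_arch_mul_indicator_mul_ideleNorm_cpow ν μinf μv S hw hgm hg,
      integral_arch_mul_indicator_mul_ideleNorm_cpow_eq ν μinf μv S hc hw hgm hg⟩⟩

end Box

end Summit.HodgeConjecture.HodgeConjecture.Cruxes.HLiu418.K2LiuIdelicUnramifiedZetaProduct

end
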